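import Mathlib
import HarnessLib
import Summits.HubbardSuperconductivity.HubbardSuperconductivity.Theorems.KLProgrammeKLRegimeEngineTowerBlockIncrLevOriented
import Summits.HubbardSuperconductivity.HubbardSuperconductivity.Theorems.KLProgrammeKLRegimeEngineTowerBlockCovTalking

/-!
# «(ℓ)-LEV-DOOR-INST», ANY talking relation and the fine one (`c = 9`) — the oriented levelled block step on the tower's own increment
# (crux K3 ENGINE, stmt-HubbardSuperconductivity-20437 `KLRegimeEngineV17F2`, stub (b) v2, levels package (ℓ), cure of located item #10 «(ℓ)-LEV-ODD»;
#  cell gate-hubbard-kl, seat hubbard-kl-k3c3-p2 g15 — E1 / the LINK-F lane may rename or supersede)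

`…TowerBlockIncrLevOriented.doorSum_klTowerIncr_le_oriented` (this seat, p678752) applies k3c2-p3's oriented door and E1's first-order
levelled door to the tower's own block with the COARSE talking relation (fat-support overlap, `c = 36`).  k3c2-p3's
`…TowerBlockCovTalking` (p678607) proves the FINE talking relation — common momentum ∧ equal spins ∧ opposite bar indices — with
`c = 9` (`card_talking_bgmFat_le_nine`, family index `≥ 1`).  This file re-threads the same composition

* §1 **`doorSum_klTowerIncr_le_oriented_of_ov`** — through ANY talking relation `ov` with count `c ≥ 1` supporting `S(F̃)ᵀ Γ S(F̃)`
  (the door's `(ov, c, hov, hCov)` kept as binders; (I2) discharged as before: `B := klTowerMeasLev`, position-only family `B′` by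
  translation invariance; (I3) kept as the `Nl` hypotheses), and
* §2 **`doorSum_klTowerIncr_le_oriented9`** — through the fine relation: line constant `9·α`, for `2 ≤ dk` (so that the input family index
  `dk − 1 ≥ 1`).
Compositions of landed theorems; nothing about the model is asserted beyond them; nothing asserts (ℓ), any stub, K3 or superconductivity.
References: BGM 2006 §2.7 (2.66), (2.70)–(2.71a), §2.8 (2.76)–(2.84), (2.88)–(2.90), (2.97)–(2.98), App. A3, App. A4 (A4.5)–(A4.8)
[cite: BenfattoGiulianiMastropietro2006].
-/

noncomputable section

namespace Summit.HubbardSuperconductivity.HubbardSuperconductivity.Theorems.EngineV8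

set_option linter.dupNamespace false -- summit = problem name (single-conjunct summit), D-0017

open Classical
open Real Finset Literature.MathematicalPhysics.QuantumLattice Literature.Probability.LatticeModels GrassmannAlgebra
open Literature.MathematicalPhysics.QuantumLattice.FermiRG Literature.MathematicalPhysics.QuantumLattice.FermiRG.BGM2006Routing
open Summit.HubbardSuperconductivity.HubbardSuperconductivity.Theorems.KLProgrammeLegKernels
open Summit.HubbardSuperconductivity.HubbardSuperconductivity.Theorems.KLRegimeSplit
open Summit.HubbardSuperconductivity.HubbardSuperconductivity.Theorems.KLRegimeWick
open Summit.HubbardSuperconductivity.HubbardSuperconductivity.Theorems.TwoPointAssembly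
open Literature.Probability.LatticeModels.BattleFederbush
open scoped Nat

variable {L M : ℕ} [NeZero L] [NeZero M]

/-! ## §1 Any talking relation -/

/-- **THE ORIENTED LEVELLED BLOCK STEP ON `Δ_k`, DOOR FORM, ANY TALKING RELATION, (I2) DISCHARGED.**  `1 ≤ d`, `1 ≤ k`, `dk ≤ J′`, `Z^K_{Λ_{dk}} ≠ 0`; UNWEIGHTED
block constants (Gram `κ`, rows/cols `α` of `S(F̃)ᵀΓS(F̃)`, radius `ρ`, overlap `(cr, cc)` of `E(F_{J′})·S(F̃)`, truncation `N₀ ≥ 2`); an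
abstract levelled majorant `Nl ≥ 0`, antitone in the level, dominating the measured levelled input arrays one level up
(`ε·klTowerMeasLev … (2(m′+1)) Fc ≤ Nl (m′+1) (Fc+1)`) and the level-`0` position-only row
(`ε·|SectorLeg|·klTowerMeasLev … (2(m′+1)) 0 ≤ Nl (m′+1) 0`), itself dominated by `Bm m′ · θ^{lumps L}` for `L ≥ 1`; the door guard
`e·α·normV(ε·klTowerMeasLev … (2m′) 0)/κ² < 1`.  Then for every pinned output leg `p`, prescribed output legs `J ∌ p`, labels `τ″` and pin
`w″`, the door-form sum of `‖kernel (map E(F_{J′})) Δ_k (2q+2) ·‖` is at most the oriented orders-≥2 right side (line constant `c·α` for a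
talking relation `ov` of the input sector legs with at most `c ≥ 1` partners supporting `S(F̃)ᵀ Γ S(F̃)`, profile functional
`(∏ Bm (δ a))·θ^{lumps (1+|J|)}`) plus the first-order binomial-prescribed right side. -/
theorem doorSum_klTowerIncr_le_oriented_of_ov {β : ℝ} (hβ : 0 < β) (U μ : ℝ) (K : TrigPolyC4v) {d k J' : ℕ} (hd : 1 ≤ d) (hk : 1 ≤ k)
    (hJ' : d * k ≤ J') (hZ : hubbardEffPartitionFnCT L M β U μ 0 K (klScale klE0 (d * k)) ≠ 0)
    (ov : SectorLeg (sectorCount (d * k - 1)) → SectorLeg (sectorCount (d * k - 1)) → Prop) [DecidableRel ov] {c : ℕ} (hc1 : 1 ≤ c)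
    (hov : ∀ σ', (univ.filter fun σ : SectorLeg (sectorCount (d * k - 1)) => ov σ σ').card ≤ c)
    (hCov : ∀ X Y, ((sectorSubMatrix L M β (bgmFatMultiplier L M klE0 β (nambuXiCT L μ K) (d * k - 1))).transpose *
      hubbardCovSliceCT L M β μ 0 K (klScale klE0 (d * (k + 1))) (klScale klE0 (d * k)) *
        sectorSubMatrix L M β (bgmFatMultiplier L M klE0 β (nambuXiCT L μ K) (d * k - 1))) X Y ≠ 0 → ov X.2 Y.2 ∧ ov Y.2 X.2)
    {κ : ℝ} (hκ : 0 < κ)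
    (hGB : IsGramBoundedR ((sectorSubMatrix L M β (bgmFatMultiplier L M klE0 β (nambuXiCT L μ K) (d * k - 1))).transpose *
      hubbardCovSliceCT L M β μ 0 K (klScale klE0 (d * (k + 1))) (klScale klE0 (d * k)) *
        sectorSubMatrix L M β (bgmFatMultiplier L M klE0 β (nambuXiCT L μ K) (d * k - 1))) κ)
    {α : ℝ} (hα : 0 < α)
    (hrow : ∀ X, ∑ Y, ‖((sectorSubMatrix L M β (bgmFatMultiplier L M klE0 β (nambuXiCT L μ K) (d * k - 1))).transpose *
        hubbardCovSliceCT L M β μ 0 K (klScale klE0 (d * (k + 1))) (klScale klE0 (d * k)) *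
          sectorSubMatrix L M β (bgmFatMultiplier L M klE0 β (nambuXiCT L μ K) (d * k - 1))) X Y‖ ≤ α)
    (hcol : ∀ Y, ∑ X, ‖((sectorSubMatrix L M β (bgmFatMultiplier L M klE0 β (nambuXiCT L μ K) (d * k - 1))).transpose *
        hubbardCovSliceCT L M β μ 0 K (klScale klE0 (d * (k + 1))) (klScale klE0 (d * k)) *
          sectorSubMatrix L M β (bgmFatMultiplier L M klE0 β (nambuXiCT L μ K) (d * k - 1))) X Y‖ ≤ α)
    {ρ : ℝ} (hρ : 0 < ρ)
    {cr cc : ℝ} (hcc0 : 0 ≤ cc)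
    (hrow' : ∀ X'', ∑ X', ‖(sectorAnalysisMatrix L M β (klAnisoFamily L M β μ K klE0 J') *
        sectorSubMatrix L M β (bgmFatMultiplier L M klE0 β (nambuXiCT L μ K) (d * k - 1))) X'' X'‖ ≤ cr)
    (hcol' : ∀ X', ∑ X'', ‖(sectorAnalysisMatrix L M β (klAnisoFamily L M β μ K klE0 J') *
        sectorSubMatrix L M β (bgmFatMultiplier L M klE0 β (nambuXiCT L μ K) (d * k - 1))) X'' X'‖ ≤ cc)
    {N₀ : ℕ} (hN₀ : 2 ≤ N₀)
    (Nl : ℕ → ℕ → ℝ) (hNl0 : ∀ m' Lv, 0 ≤ Nl m' Lv) (hanti : ∀ m' Lv Lv', Lv ≤ Lv' → Nl m' Lv' ≤ Nl m' Lv)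
    (hBN : ∀ m' Fc, imagTimeWeight β M * klTowerMeasLev L M β U μ K d k (2 * (m' + 1)) Fc ≤ Nl (m' + 1) (Fc + 1))
    (hB'N0 : ∀ m', imagTimeWeight β M * ((Fintype.card (SectorLeg (sectorCount (d * k - 1))) : ℝ) *
      klTowerMeasLev L M β U μ K d k (2 * (m' + 1)) 0) ≤ Nl (m' + 1) 0)
    (Bm : ℕ → ℝ) (hBm0 : ∀ m', 0 ≤ Bm m') {θ : ℝ} (hθ0 : 0 ≤ θ) (hdom : ∀ m' Lv, 1 ≤ Lv → Nl m' Lv ≤ Bm m' * θ ^ lumps Lv)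
    (hθV : Real.exp 1 * α * normV (SpaceTimeIdx L M × SectorLeg (sectorCount (d * k - 1))) κ ρ
      (fun m' => imagTimeWeight β M * klTowerMeasLev L M β U μ K d k (2 * m') 0) / κ ^ 2 < 1)
    {q : ℕ} (p : Fin (2 * q + 1 + 1)) (J : Finset (Fin (2 * q + 1 + 1))) (hp : p ∉ J)
    (τ'' : Fin (2 * q + 1 + 1) → SectorLeg (sectorCount J')) (w'' : SpaceTimeIdx L M × SectorLeg (sectorCount J')) :
    ∑ X'' ∈ univ.filter (fun X'' : Fin (2 * q + 1 + 1) → SpaceTimeIdx L M × SectorLeg (sectorCount J') =>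
        X'' p = w'' ∧ ∀ j ∈ J, (X'' j).2 = τ'' j),
        ‖kernel ℂ (ExteriorAlgebra.map (Matrix.toLin' (sectorAnalysisMatrix L M β (klAnisoFamily L M β μ K klE0 J')))
          (klTowerIncr L M β U μ K d k)) (2 * q + 1 + 1) X''‖ ≤
      cr * cc ^ (2 * q + 1) * ((∏ j ∈ J, (((univ.filter fun ℓ' : SectorLeg (sectorCount (d * k - 1)) =>
          (∃ q' : FreqMomentum L M, klAnisoFamily L M β μ K klE0 J' (τ'' j).1.1 q' ≠ 0 ∧
            bgmFatMultiplier L M klE0 β (nambuXiCT L μ K) (d * k - 1) ℓ'.1.1 q' ≠ 0) ∧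
          ℓ'.1.2 = (τ'' j).1.2 ∧ ℓ'.2 = (τ'' j).2).card : ℕ) : ℝ)) *
        (∑ n ∈ Ico 2 N₀, (κ⁻¹ ^ (2 * q + 1 + 1) * κ⁻¹ ^ (2 * (n - 1)) * (((c : ℝ) * α) ^ (n - 1) * Real.exp n)) *
            ∑ δ ∈ (Fintype.piFinset fun _ : Fin n => range (Fintype.card (SpaceTimeIdx L M × SectorLeg (sectorCount (d * k - 1))) / 2 + 1)) with
                2 * q + 1 + 1 + 2 * (n - 1) ≤ ∑ a, 2 * δ a,
              ∑ pf : J → Fin n, ((∏ j, ((2 * δ (pf j) : ℕ) : ℝ)) / ((∑ a, 2 * δ a : ℕ) : ℝ) ^ J.card) *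
                ((Real.exp 3 * κ) ^ (∑ a, 2 * δ a) * ((∏ a, Bm (δ a)) * θ ^ lumps (1 + J.card))) +
          ρ⁻¹ ^ (2 * q + 1 + 1) * (Real.exp 1 * normV (SpaceTimeIdx L M × SectorLeg (sectorCount (d * k - 1))) κ ρ
              (fun m' => imagTimeWeight β M * klTowerMeasLev L M β U μ K d k (2 * m') 0)) *
            (Real.exp 1 * α * normV (SpaceTimeIdx L M × SectorLeg (sectorCount (d * k - 1))) κ ρ
                (fun m' => imagTimeWeight β M * klTowerMeasLev L M β U μ K d k (2 * m') 0) / κ ^ 2) ^ (N₀ - 1) /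
            (1 - Real.exp 1 * α * normV (SpaceTimeIdx L M × SectorLeg (sectorCount (d * k - 1))) κ ρ
                (fun m' => imagTimeWeight β M * klTowerMeasLev L M β U μ K d k (2 * m') 0) / κ ^ 2))) +
      cr * cc ^ (2 * q + 1) *
        ∑ m' ∈ range (Fintype.card (SpaceTimeIdx L M × SectorLeg (sectorCount (d * k - 1))) / 2 + 1), (if q + 1 < m' then
          ((((2 * (q + 1)).factorial : ℝ))⁻¹ * ((∏ j ∈ univ.filter (fun j : Fin (2 * (q + 1)) => j ∉ J), (2 * m' - (j : ℕ)) : ℕ) : ℝ)) *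
            ((2 * m' : ℕ) : ℝ) ^ J.card * κ ^ (2 * m' - 2 * (q + 1)) *
              ((27 : ℝ) ^ J.card * (imagTimeWeight β M * klTowerMeasLev L M β U μ K d k (2 * m') J.card)) else 0) := by
  have hβ' : β ≠ 0 := hβ.ne'
  have hJ₁ : 1 ≤ d * k := le_trans hd (Nat.le_mul_of_pos_right d hk)
  have hJ : d * k ≤ d * (k + 1) := Nat.mul_le_mul_left d (Nat.le_succ k)
  have hG : klTowerInput L M β U μ K d k ∈ evenPart ℂ (HubbardFieldIdx L M) := klEffectiveAction_mem_evenPart hβ' U μ K klE0 (d * k)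
  have hG0 : constPart ℂ (klTowerInput L M β U μ K d k) = 0 := constPart_klEffectiveAction_eq_zero β U μ K klE0 (d * k) hZ
  -- the input families: measured levelled arrays (full pin) and the position-only family
  set B : ℕ → ℕ → ℝ := fun m c => klTowerMeasLev L M β U μ K d k (2 * m) c with hB
  set B' : ℕ → ℕ → ℝ := fun m Fc => if Fc = 0 then
      (Fintype.card (SectorLeg (sectorCount (d * k - 1))) : ℝ) * klTowerMeasLev L M β U μ K d k (2 * m) 0
    else klTowerMeasLev L M β U μ K d k (2 * m) (Fc - 1) with hB'
  have hB0 : ∀ m c, 0 ≤ B m c := fun m c => klTowerMeasLev_nonneg hβ.le U μ K d k _ c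
  have hBin : ∀ (m' Fc : ℕ) (E : Finset (Fin (2 * m' + 1 + 1))) (τ' : Fin (2 * m' + 1 + 1) → SectorLeg (sectorCount (d * k - 1)))
      (q' : Fin (2 * m' + 1 + 1)), q' ∈ E → E.card = Fc + 1 → ∀ y : SpaceTimeIdx L M,
        imagTimeWeight β M ^ (2 * m' + 1) *
          ∑ σ ∈ univ.filter (fun σ : Fin (2 * m' + 1 + 1) → SectorLeg (sectorCount (d * k - 1)) => ∀ e ∈ E, σ e = τ' e),
            ∑ x ∈ univ.filter (fun x : Fin (2 * m' + 1 + 1) → SpaceTimeIdx L M => x q' = y),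
              ‖sectorisedKernel L M β (klAnisoFamily L M β μ K klE0 (d * k - 1)) (klTowerInput L M β U μ K d k) (2 * m' + 1 + 1) σ x‖ ≤
          B (m' + 1) Fc :=
    fun m' Fc E τ' q' hq hE y => doorInput_klTowerInput_le_klTowerMeasLev hβ.le U μ K d k m' Fc E τ' q' hq hE y
  -- the weighted (weight `1`) forms of the two input rows
  have hBw : ∀ (m' Fc : ℕ) (E : Finset (Fin (2 * m' + 1 + 1))) (τ' : Fin (2 * m' + 1 + 1) → SectorLeg (sectorCount (d * k - 1)))
      (q' : Fin (2 * m' + 1 + 1)), q' ∈ E → E.card = Fc + 1 → ∀ y : SpaceTimeIdx L M,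
        imagTimeWeight β M ^ (2 * m' + 1) *
          ∑ σ ∈ univ.filter (fun σ : Fin (2 * m' + 1 + 1) → SectorLeg (sectorCount (d * k - 1)) => ∀ e ∈ E, σ e = τ' e),
            ∑ x ∈ univ.filter (fun x : Fin (2 * m' + 1 + 1) → SpaceTimeIdx L M => x q' = y),
              (fun _ : Finset Unit => (1 : ℝ)) ((univ.image fun i => (x i, σ i)).image (fun _ => ())) *
              ‖sectorisedKernel L M β (klAnisoFamily L M β μ K klE0 (d * k - 1)) (klTowerInput L M β U μ K d k) (2 * m' + 1 + 1) σ x‖ ≤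
          B (m' + 1) Fc := fun m' Fc E τ' q' hq hE y => by
    simpa only [one_mul] using hBin m' Fc E τ' q' hq hE y
  have hB'w : ∀ (m' Fc : ℕ) (E : Finset (Fin (2 * m' + 1 + 1))) (τ' : Fin (2 * m' + 1 + 1) → SectorLeg (sectorCount (d * k - 1)))
      (t : Fin (2 * m' + 1 + 1)), t ∉ E → E.card = Fc → ∀ yσ : SectorLeg (sectorCount (d * k - 1)) → SpaceTimeIdx L M,
        imagTimeWeight β M ^ (2 * m' + 1) *
          ∑ σ ∈ univ.filter (fun σ : Fin (2 * m' + 1 + 1) → SectorLeg (sectorCount (d * k - 1)) => ∀ e ∈ E, σ e = τ' e),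
            ∑ x ∈ univ.filter (fun x : Fin (2 * m' + 1 + 1) → SpaceTimeIdx L M => x t = yσ (σ t)),
              (fun _ : Finset Unit => (1 : ℝ)) ((univ.image fun i => (x i, σ i)).image (fun _ => ())) *
              ‖sectorisedKernel L M β (klAnisoFamily L M β μ K klE0 (d * k - 1)) (klTowerInput L M β U μ K d k) (2 * m' + 1 + 1) σ x‖ ≤
          B' (m' + 1) Fc := fun m' Fc E τ' t _ hE yσ => by
    simpa only [one_mul] using swInput_klTowerInput_le_towerBsw hβ U μ K d k m' Fc E τ' t hE yσ
  -- (I3) rows for the position-only family from `hBN` and the level-`0` row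
  have hB'N : ∀ m' Fc, imagTimeWeight β M * B' (m' + 1) Fc ≤ Nl (m' + 1) Fc := by
    intro m' Fc
    rcases Fc with _ | F₀
    · rw [hB', towerBsw_zero]; exact hB'N0 m'
    · rw [hB', towerBsw_succ]; exact hBN m' F₀
  have hBN' : ∀ m' Fc, imagTimeWeight β M * B (m' + 1) Fc ≤ Nl (m' + 1) (Fc + 1) := fun m' Fc => hBN m' Fc
  -- the weight-`1` rows/cols
  have hroww : ∀ X, ∑ Y, ‖((sectorSubMatrix L M β (bgmFatMultiplier L M klE0 β (nambuXiCT L μ K) (d * k - 1))).transpose *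
        hubbardCovSliceCT L M β μ 0 K (klScale klE0 (d * (k + 1))) (klScale klE0 (d * k)) *
          sectorSubMatrix L M β (bgmFatMultiplier L M klE0 β (nambuXiCT L μ K) (d * k - 1))) X Y‖ *
        (fun _ : Finset Unit => (1 : ℝ)) {(fun _ : SpaceTimeIdx L M × SectorLeg (sectorCount (d * k - 1)) => ()) X,
          (fun _ : SpaceTimeIdx L M × SectorLeg (sectorCount (d * k - 1)) => ()) Y} ≤ α := fun X => by
    simpa only [mul_one] using hrow X
  have hcolw : ∀ Y, ∑ X, ‖((sectorSubMatrix L M β (bgmFatMultiplier L M klE0 β (nambuXiCT L μ K) (d * k - 1))).transpose *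
        hubbardCovSliceCT L M β μ 0 K (klScale klE0 (d * (k + 1))) (klScale klE0 (d * k)) *
          sectorSubMatrix L M β (bgmFatMultiplier L M klE0 β (nambuXiCT L μ K) (d * k - 1))) X Y‖ *
        (fun _ : Finset Unit => (1 : ℝ)) {(fun _ : SpaceTimeIdx L M × SectorLeg (sectorCount (d * k - 1)) => ()) X,
          (fun _ : SpaceTimeIdx L M × SectorLeg (sectorCount (d * k - 1)) => ()) Y} ≤ α := fun Y => by
    simpa only [mul_one] using hcol Y
  have hrow'w : ∀ X'', ∑ X', ‖(sectorAnalysisMatrix L M β (klAnisoFamily L M β μ K klE0 J') *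
        sectorSubMatrix L M β (bgmFatMultiplier L M klE0 β (nambuXiCT L μ K) (d * k - 1))) X'' X'‖ *
        (fun _ : Finset Unit => (1 : ℝ)) {(fun _ : SpaceTimeIdx L M × SectorLeg (sectorCount J') => ()) X'',
          (fun _ : SpaceTimeIdx L M × SectorLeg (sectorCount (d * k - 1)) => ()) X'} ≤ cr := fun X'' => by
    simpa only [mul_one] using hrow' X''
  have hcol'w : ∀ X', ∑ X'', ‖(sectorAnalysisMatrix L M β (klAnisoFamily L M β μ K klE0 J') *
        sectorSubMatrix L M β (bgmFatMultiplier L M klE0 β (nambuXiCT L μ K) (d * k - 1))) X'' X'‖ *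
        (fun _ : Finset Unit => (1 : ℝ)) {(fun _ : SpaceTimeIdx L M × SectorLeg (sectorCount J') => ()) X'',
          (fun _ : SpaceTimeIdx L M × SectorLeg (sectorCount (d * k - 1)) => ()) X'} ≤ cc := fun X' => by
    simpa only [mul_one] using hcol' X'
  -- a default sector of the input alphabet
  obtain ⟨σdef⟩ : Nonempty (SectorLeg (sectorCount (d * k - 1))) := ⟨((⟨0, sectorCount_pos _⟩, 0), 0)⟩
  -- the two doors at this `(p, J, τ″, w″)`
  have h2 := blockStep_ordersGe2_wtOriented_le (L := L) (M := M) (IsTreeWeight.const_one (Λ := Unit)) hβ μ K hJ₁ hJ hJ'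
    (fun _ : SpaceTimeIdx L M × SectorLeg (sectorCount (d * k - 1)) => ())
    (fun _ : SpaceTimeIdx L M × SectorLeg (sectorCount J') => ())
    (klTowerInput L M β U μ K d k) hG hG0 σdef ov hc1 hov hCov
    hκ hGB B B' hB0 hBw hB'w Nl hNl0 hanti hBN' hB'N Bm hBm0 hθ0 hdom hα hroww hcolw hρ hθV hcc0 hrow'w hcol'w hN₀
    (m := 2 * q + 1) p J hp τ'' w''
  simp only [one_mul] at h2
  have h1 := blockStep_firstOrder_lev_le (L := L) (M := M) hβ μ K hJ₁ hJ hJ' (klTowerInput L M β U μ K d k) hG hκ.le hGB B hB0 hBin hcc0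
    hrow' hcol' (q := q) p J hp τ'' w''
  -- split `Δ_k` inside the door-form sum
  rw [klTowerIncr_eq_ordersGe2_add_firstOrder β U μ K d k hZ, map_add]
  refine le_trans (sum_le_sum fun X _ => ?_) (le_trans (le_of_eq sum_add_distrib) (add_le_add h2 h1))
  rw [kernel_add]
  exact norm_add_le _ _

/-! ## §2 The fine talking relation, `c = 9` -/

/-- **THE ORIENTED LEVELLED BLOCK STEP ON `Δ_k`, DOOR FORM, FINE TALKING RELATION (`c = 9`), (I1)(I2) DISCHARGED.**  `2 ≤ dk`;  `1 ≤ d`, `1 ≤ k`, `dk ≤ J′`, `Z^K_{Λ_{dk}} ≠ 0`; UNWEIGHTED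
block constants (Gram `κ`, rows/cols `α` of `S(F̃)ᵀΓS(F̃)`, radius `ρ`, overlap `(cr, cc)` of `E(F_{J′})·S(F̃)`, truncation `N₀ ≥ 2`); an
abstract levelled majorant `Nl ≥ 0`, antitone in the level, dominating the measured levelled input arrays one level up
(`ε·klTowerMeasLev … (2(m′+1)) Fc ≤ Nl (m′+1) (Fc+1)`) and the level-`0` position-only row
(`ε·|SectorLeg|·klTowerMeasLev … (2(m′+1)) 0 ≤ Nl (m′+1) 0`), itself dominated by `Bm m′ · θ^{lumps L}` for `L ≥ 1`; the door guard
`e·α·normV(ε·klTowerMeasLev … (2m′) 0)/κ² < 1`.  Then for every pinned output leg `p`, prescribed output legs `J ∌ p`, labels `τ″` and pin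
`w″`, the door-form sum of `‖kernel (map E(F_{J′})) Δ_k (2q+2) ·‖` is at most the oriented orders-≥2 right side (line constant `9·α`,
k3c2-p3's talking relation: common momentum ∧ equal spins ∧ opposite bar indices, `card_talking_bgmFat_le_nine`; profile functional
`(∏ Bm (δ a))·θ^{lumps (1+|J|)}`) plus the first-order binomial-prescribed right side. -/
theorem doorSum_klTowerIncr_le_oriented9 {β : ℝ} (hβ : 0 < β) (U μ : ℝ) (K : TrigPolyC4v) {d k J' : ℕ} (hd : 1 ≤ d) (hk : 1 ≤ k)
    (hJ' : d * k ≤ J') (hdk : 2 ≤ d * k) (hZ : hubbardEffPartitionFnCT L M β U μ 0 K (klScale klE0 (d * k)) ≠ 0)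
    {κ : ℝ} (hκ : 0 < κ)
    (hGB : IsGramBoundedR ((sectorSubMatrix L M β (bgmFatMultiplier L M klE0 β (nambuXiCT L μ K) (d * k - 1))).transpose *
      hubbardCovSliceCT L M β μ 0 K (klScale klE0 (d * (k + 1))) (klScale klE0 (d * k)) *
        sectorSubMatrix L M β (bgmFatMultiplier L M klE0 β (nambuXiCT L μ K) (d * k - 1))) κ)
    {α : ℝ} (hα : 0 < α)
    (hrow : ∀ X, ∑ Y, ‖((sectorSubMatrix L M β (bgmFatMultiplier L M klE0 β (nambuXiCT L μ K) (d * k - 1))).transpose *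
        hubbardCovSliceCT L M β μ 0 K (klScale klE0 (d * (k + 1))) (klScale klE0 (d * k)) *
          sectorSubMatrix L M β (bgmFatMultiplier L M klE0 β (nambuXiCT L μ K) (d * k - 1))) X Y‖ ≤ α)
    (hcol : ∀ Y, ∑ X, ‖((sectorSubMatrix L M β (bgmFatMultiplier L M klE0 β (nambuXiCT L μ K) (d * k - 1))).transpose *
        hubbardCovSliceCT L M β μ 0 K (klScale klE0 (d * (k + 1))) (klScale klE0 (d * k)) *
          sectorSubMatrix L M β (bgmFatMultiplier L M klE0 β (nambuXiCT L μ K) (d * k - 1))) X Y‖ ≤ α)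
    {ρ : ℝ} (hρ : 0 < ρ)
    {cr cc : ℝ} (hcc0 : 0 ≤ cc)
    (hrow' : ∀ X'', ∑ X', ‖(sectorAnalysisMatrix L M β (klAnisoFamily L M β μ K klE0 J') *
        sectorSubMatrix L M β (bgmFatMultiplier L M klE0 β (nambuXiCT L μ K) (d * k - 1))) X'' X'‖ ≤ cr)
    (hcol' : ∀ X', ∑ X'', ‖(sectorAnalysisMatrix L M β (klAnisoFamily L M β μ K klE0 J') *
        sectorSubMatrix L M β (bgmFatMultiplier L M klE0 β (nambuXiCT L μ K) (d * k - 1))) X'' X'‖ ≤ cc)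
    {N₀ : ℕ} (hN₀ : 2 ≤ N₀)
    (Nl : ℕ → ℕ → ℝ) (hNl0 : ∀ m' Lv, 0 ≤ Nl m' Lv) (hanti : ∀ m' Lv Lv', Lv ≤ Lv' → Nl m' Lv' ≤ Nl m' Lv)
    (hBN : ∀ m' Fc, imagTimeWeight β M * klTowerMeasLev L M β U μ K d k (2 * (m' + 1)) Fc ≤ Nl (m' + 1) (Fc + 1))
    (hB'N0 : ∀ m', imagTimeWeight β M * ((Fintype.card (SectorLeg (sectorCount (d * k - 1))) : ℝ) *
      klTowerMeasLev L M β U μ K d k (2 * (m' + 1)) 0) ≤ Nl (m' + 1) 0)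
    (Bm : ℕ → ℝ) (hBm0 : ∀ m', 0 ≤ Bm m') {θ : ℝ} (hθ0 : 0 ≤ θ) (hdom : ∀ m' Lv, 1 ≤ Lv → Nl m' Lv ≤ Bm m' * θ ^ lumps Lv)
    (hθV : Real.exp 1 * α * normV (SpaceTimeIdx L M × SectorLeg (sectorCount (d * k - 1))) κ ρ
      (fun m' => imagTimeWeight β M * klTowerMeasLev L M β U μ K d k (2 * m') 0) / κ ^ 2 < 1)
    {q : ℕ} (p : Fin (2 * q + 1 + 1)) (J : Finset (Fin (2 * q + 1 + 1))) (hp : p ∉ J)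
    (τ'' : Fin (2 * q + 1 + 1) → SectorLeg (sectorCount J')) (w'' : SpaceTimeIdx L M × SectorLeg (sectorCount J')) :
    ∑ X'' ∈ univ.filter (fun X'' : Fin (2 * q + 1 + 1) → SpaceTimeIdx L M × SectorLeg (sectorCount J') =>
        X'' p = w'' ∧ ∀ j ∈ J, (X'' j).2 = τ'' j),
        ‖kernel ℂ (ExteriorAlgebra.map (Matrix.toLin' (sectorAnalysisMatrix L M β (klAnisoFamily L M β μ K klE0 J')))
          (klTowerIncr L M β U μ K d k)) (2 * q + 1 + 1) X''‖ ≤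
      cr * cc ^ (2 * q + 1) * ((∏ j ∈ J, (((univ.filter fun ℓ' : SectorLeg (sectorCount (d * k - 1)) =>
          (∃ q' : FreqMomentum L M, klAnisoFamily L M β μ K klE0 J' (τ'' j).1.1 q' ≠ 0 ∧
            bgmFatMultiplier L M klE0 β (nambuXiCT L μ K) (d * k - 1) ℓ'.1.1 q' ≠ 0) ∧
          ℓ'.1.2 = (τ'' j).1.2 ∧ ℓ'.2 = (τ'' j).2).card : ℕ) : ℝ)) *
        (∑ n ∈ Ico 2 N₀, (κ⁻¹ ^ (2 * q + 1 + 1) * κ⁻¹ ^ (2 * (n - 1)) * ((((9 : ℕ) : ℝ) * α) ^ (n - 1) * Real.exp n)) *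
            ∑ δ ∈ (Fintype.piFinset fun _ : Fin n => range (Fintype.card (SpaceTimeIdx L M × SectorLeg (sectorCount (d * k - 1))) / 2 + 1)) with
                2 * q + 1 + 1 + 2 * (n - 1) ≤ ∑ a, 2 * δ a,
              ∑ pf : J → Fin n, ((∏ j, ((2 * δ (pf j) : ℕ) : ℝ)) / ((∑ a, 2 * δ a : ℕ) : ℝ) ^ J.card) *
                ((Real.exp 3 * κ) ^ (∑ a, 2 * δ a) * ((∏ a, Bm (δ a)) * θ ^ lumps (1 + J.card))) +
          ρ⁻¹ ^ (2 * q + 1 + 1) * (Real.exp 1 * normV (SpaceTimeIdx L M × SectorLeg (sectorCount (d * k - 1))) κ ρ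
              (fun m' => imagTimeWeight β M * klTowerMeasLev L M β U μ K d k (2 * m') 0)) *
            (Real.exp 1 * α * normV (SpaceTimeIdx L M × SectorLeg (sectorCount (d * k - 1))) κ ρ
                (fun m' => imagTimeWeight β M * klTowerMeasLev L M β U μ K d k (2 * m') 0) / κ ^ 2) ^ (N₀ - 1) /
            (1 - Real.exp 1 * α * normV (SpaceTimeIdx L M × SectorLeg (sectorCount (d * k - 1))) κ ρ
                (fun m' => imagTimeWeight β M * klTowerMeasLev L M β U μ K d k (2 * m') 0) / κ ^ 2))) +
      cr * cc ^ (2 * q + 1) *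
        ∑ m' ∈ range (Fintype.card (SpaceTimeIdx L M × SectorLeg (sectorCount (d * k - 1))) / 2 + 1), (if q + 1 < m' then
          ((((2 * (q + 1)).factorial : ℝ))⁻¹ * ((∏ j ∈ univ.filter (fun j : Fin (2 * (q + 1)) => j ∉ J), (2 * m' - (j : ℕ)) : ℕ) : ℝ)) *
            ((2 * m' : ℕ) : ℝ) ^ J.card * κ ^ (2 * m' - 2 * (q + 1)) *
              ((27 : ℝ) ^ J.card * (imagTimeWeight β M * klTowerMeasLev L M β U μ K d k (2 * m') J.card)) else 0) := by
  have hβ' : β ≠ 0 := hβ.ne'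
  have hk1 : 1 ≤ d * k - 1 := by omega
  exact doorSum_klTowerIncr_le_oriented_of_ov hβ U μ K hd hk hJ' hZ
    (fun σ σ' : SectorLeg (sectorCount (d * k - 1)) =>
      (∃ q' : FreqMomentum L M, bgmFatMultiplier L M klE0 β (nambuXiCT L μ K) (d * k - 1) σ.1.1 q' *
          bgmFatMultiplier L M klE0 β (nambuXiCT L μ K) (d * k - 1) σ'.1.1 q' ≠ 0) ∧ σ.1.2 = σ'.1.2 ∧ σ.2 ≠ σ'.2)
    (by norm_num) (fun σ' => card_talking_bgmFat_le_nine (L := L) (M := M) (e₀ := klE0) (β := β) (μ := μ) (Kp := K) hk1 σ')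
    (fun X Y hXY =>
      ⟨talking_of_sectorSub_transpose_covSliceCT_sectorSub_ne_zero hβ' μ K _ _ _ X Y hXY,
        talking_symm _ (talking_of_sectorSub_transpose_covSliceCT_sectorSub_ne_zero hβ' μ K _ _ _ X Y hXY)⟩)
    hκ hGB hα hrow hcol hρ hcc0 hrow' hcol' hN₀ Nl hNl0 hanti hBN hB'N0 Bm hBm0 hθ0 hdom hθV p J hp τ'' w''

end Summit.HubbardSuperconductivity.HubbardSuperconductivity.Theorems.EngineV8

end
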